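import Summits.BirchSwinnertonDyer.BirchSwinnertonDyer.Theorems.UniversalToricDescentResidualNormSpan
import HarnessLib

/-!
# Route UniversalToricDescent — the span forced by a non-zero norm, QUOTIENT / COUNTING form
# (brick 4c of the port stub `stub_residualLinkMult`, line `beta-road` v5 on crux `TwinAlgMuZeroAtThree`, stmt-BirchSwinnertonDyer-24737)

Lead prover bsd-wall-utd-p1 g23 (`--supports stmt-BirchSwinnertonDyer-24737`). Counting corollary of
`…ResidualNormSpan.succ_le_finrank_of_sum_pow_apply_ne_zero` (p737965) in the shape the finite-level two-sided link consumes: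
an additive group `S` killed by `p` (a mod-`p` Selmer group of the layer `K_{k+m}`), a subgroup `Z ≤ S` (the classes whose local
signature at the prime above `p` vanishes), an additive endomorphism `φ` of `S` preserving `Z` with `φ^{p^N} = 1` (conjugation by the
topological generator `γ`), and `u ∈ S` whose NORM `∑_{i<p^m} φ^{p^k i} u` is NOT in `Z` (`…HeegnerLayerSignature`, p738502):

* **`pow_le_natCard_quotient_of_sum_pow_apply_not_mem`** — `p^{p^{k+m} − p^k + 1} ≤ #(S ⧸ Z)`; equivalently (Poitou–Tate bookkeeping)
  the image of `S` in the local group at the prime above `p` has at least `p^{k+m} − p^k + 1` independent directions.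

THEOREMS ONLY (no definition, no named fact, no `sorry`); Mathlib + p737965. BSD is not advanced by this file.
References: [Washington1997] §13.2; folklore.
-/

set_option linter.dupNamespace false
set_option autoImplicit false

open Finset

namespace Summit.BirchSwinnertonDyer.BirchSwinnertonDyer.Theorems.UniversalToricDescentResidualNormSpanQuotient

open Summit.BirchSwinnertonDyer.BirchSwinnertonDyer.Theorems.UniversalToricDescentResidualNormSpan

variable {p : ℕ} [hp : Fact p.Prime] {S : Type*} [AddCommGroup S]

/-- **Counting form of the span bound.** `S` an additive group killed by `p`, `Z ≤ S` with `S ⧸ Z` finite, `φ ∈ End(S)` preserving `Z`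
with `φ^{p^N} = 1`, `u ∈ S` with `∑_{i<p^m} φ^{p^k i} u ∉ Z`: then `p^{p^{k+m} − p^k + 1} ≤ #(S ⧸ Z)`.
[cite: Washington1997, §13.2] -/
theorem pow_le_natCard_quotient_of_sum_pow_apply_not_mem (hS : ∀ s : S, p • s = 0)
    (Z : AddSubgroup S) [Finite (S ⧸ Z)] (φ : AddMonoid.End S) (hφZ : ∀ s ∈ Z, φ s ∈ Z) {N : ℕ}
    (hφ : φ ^ p ^ N = 1) (u : S) (k m : ℕ) (hu : ∑ i ∈ range (p ^ m), (φ ^ (p ^ k * i)) u ∉ Z) :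
    p ^ (p ^ (k + m) - p ^ k + 1) ≤ Nat.card (S ⧸ Z) := by
  -- `S ⧸ Z` as an `𝔽_p`-vector space
  haveI : Module (ZMod p) (S ⧸ Z) := QuotientAddGroup.zmodModule (fun x ↦ by rw [hS x]; exact Z.zero_mem)
  haveI : Module.Finite (ZMod p) (S ⧸ Z) := Module.Finite.of_finite
  -- the induced endomorphism
  let ψ : Module.End (ZMod p) (S ⧸ Z) := (QuotientAddGroup.map Z Z φ hφZ).toZModLinearMap p
  have hψpow : ∀ (i : ℕ) (s : S),
      (ψ ^ i) (QuotientAddGroup.mk' Z s) = QuotientAddGroup.mk' Z ((φ ^ i) s) := by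
    intro i s
    induction i with
    | zero => rfl
    | succ i ih =>
      rw [pow_succ', pow_succ', Module.End.mul_apply, AddMonoid.End.coe_mul, Function.comp_apply, ih]
      rfl
  have hψN : ψ ^ p ^ N = 1 := by
    refine LinearMap.ext fun x ↦ ?_
    obtain ⟨s, rfl⟩ := QuotientAddGroup.mk'_surjective Z x
    rw [hψpow, hφ, Module.End.one_apply, AddMonoid.End.coe_one, id_eq]
  have hu' : (∑ i ∈ range (p ^ m), ψ ^ (p ^ k * i)) (QuotientAddGroup.mk' Z u) ≠ 0 := by
    rw [LinearMap.sum_apply]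
    simp_rw [hψpow]
    rw [← map_sum, ne_eq, QuotientAddGroup.mk'_apply, QuotientAddGroup.eq_zero_iff]
    exact hu
  have hle := succ_le_finrank_of_sum_pow_apply_ne_zero ψ hψN (QuotientAddGroup.mk' Z u) k m hu' ⊤
    (fun _ ↦ Submodule.mem_top)
  rw [finrank_top] at hle
  rw [Module.natCard_eq_pow_finrank (K := ZMod p) (V := S ⧸ Z), Nat.card_zmod]
  exact Nat.pow_le_pow_right hp.out.pos hle

end Summit.BirchSwinnertonDyer.BirchSwinnertonDyer.Theorems.UniversalToricDescentResidualNormSpanQuotient
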